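import Mathlib
import Summits.ResolutionOfSingularities.ResolutionOfSingularities.Theorems.WeightedInvariantLocalWeightedDropTOT2CurveConflictDivTwo
import Summits.ResolutionOfSingularities.ResolutionOfSingularities.Theorems.WeightedInvariantLocalWeightedDropNCResPresentationDefs
import Summits.ResolutionOfSingularities.ResolutionOfSingularities.Theorems.WeightedInvariantLocalWeightedDropPolyDescentCompare

/-!
# `LocalWeightedDrop`, TOT2-LINE regime (P), piece (P3) — KERNEL REGRESSION TEST #3 for the conflict budget: a PSEUDO-CONFLICT born by the
# `V(y,u₁)` curve move with both letters present (res-L1-w43-lead-1's hand computation 2026-08-27T18:42:21Z, kernel-checked)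

Crux item stmt-ResolutionOfSingularities-8899 `WeightedInvariant.LocalWeightedDrop` (route `ResolutionOfSingularities/WeightedInvariant`), ENGINE
skeleton v34 (80c4710965b6845c), registered stub `stub_regimePresented`, piece (P3).  [OURS · L1 W4.3 · chain w43 · seat res-L1-w43-stub-1 gen 6;
def-free; in the style of res-type-088's `…TOT2CurveConflictBirthExample` (p539740); nothing here is a statement of any manuscript; AI-produced,
gate-checked, weaker than expert review.]

THE EXAMPLE.  `d = 2`, `A = (u₁²(u₂ + u₁)³, 0)`, boundary `N = {u₂}`.  `V(y,u₁)` is permissible (`isPermissibleOneT_curveOneExample`), so the selector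
strategy's family successor is `A′ = divOneT 2 A = ((u₂ + u₁)³, 0)` with `N′ = {u₁, u₂}` (`succFamilySel_curveOneExample`).  Downstairs all pairs among
the branch `V(u₁)`, the branch `D = V(u₂ + u₁)` and the letter `V(u₂)` are transverse.  Upstairs: `¬ IsPermissibleOneT` (`u₁² ∤ (u₂+u₁)³`),
`¬ IsPermissibleTwoT` (`u₂² ∤ (u₂+u₁)³`), and the graph curve with datum `h = −1` (shear `u₂ ↦ u₂ − u₁`: `(u₂+u₁)³ ↦ u₂³`) is permissible; with
`u₂ ∈ N′` this is `NCPoly.Conflict 2 A′ N′` (`conflict_divOneT_curveOneExample`).  CONSEQUENCE (lead-1): any budget `M` with `hM_conf` strict at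
conflicts has `M 2 A′ N′ ≥ 1`, hence by `hM_succ` `M 2 A {u₂} ≥ 1` on a state without tangencies — a potential made only of `(contact − 1)`-terms
and the pseudo-indicator of S-CRV-D-DESIGN v2.1 vanishes on both states and cannot satisfy the interface.
-/

set_option linter.dupNamespace false -- mandated namespace of this single-conjunct summit

noncomputable section

namespace Summit.ResolutionOfSingularities.ResolutionOfSingularities.Theorems

namespace TOT2Curve

open MvPowerSeries PolyDescent MonicDescent WildMonic Literature.AlgebraicGeometry.Resolution

variable {k : Type} [Field k]

/-! ## Small computations -/

/-- A constant is `u₂`-free. -/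
theorem C_noY (c : k) : ∀ e : Fin 2 →₀ ℕ, e 1 ≠ 0 → coeff e (C c : MvPowerSeries (Fin 2) k) = 0 := by
  intro e he
  rw [coeff_C, if_neg]
  rintro rfl
  exact he (by simp)

/-- The shear by `−1` (`u₂ ↦ u₂ − u₁`) straightens the branch: `(u₂ + u₁)³ ↦ u₂³`. -/
theorem shear_neg_one_branch : shear (C (-1)) ((X 1 + X 0) ^ 3 : MvPowerSeries (Fin 2) k) = X 1 ^ 3 := by
  have hs := hasSubst_of_constantCoeff_zero (constantCoeff_shearFamily (k := k) (C (-1)))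
  rw [shear_eq, ← coe_substAlgHom hs, map_pow, map_add, coe_substAlgHom, subst_X hs, subst_X hs]
  simp only [Matrix.cons_val_zero, Matrix.cons_val_one]
  rw [map_neg, map_one]
  ring

/-- `u₁² ∤ (u₂ + u₁)³` (the `u₂³`-coefficient is `1`). -/
theorem not_X_zero_sq_dvd_cube : ¬ (X 0 : MvPowerSeries (Fin 2) k) ^ 2 ∣ (X 1 + X 0) ^ 3 := by
  intro h
  have h0 := (X_pow_dvd_iff.mp h) (Finsupp.single 1 3) (by simp)
  have hsplit : ((X 1 + X 0) ^ 3 : MvPowerSeries (Fin 2) k) = X 0 * (3 * X 1 ^ 2 + 3 * X 1 * X 0 + X 0 ^ 2) + X 1 ^ 3 := by ring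
  have h1 : coeff (Finsupp.single 1 3) (X 0 * (3 * X 1 ^ 2 + 3 * X 1 * X 0 + X 0 ^ 2) : MvPowerSeries (Fin 2) k) = 0 :=
    (X_dvd_iff.mp (dvd_mul_right (X 0) _)) _ (by simp)
  rw [hsplit, map_add, h1, zero_add, X_pow_eq, coeff_monomial_same] at h0
  exact one_ne_zero h0

/-- `u₂² ∤ (u₂ + u₁)³` (the `u₁³`-coefficient is `1`). -/
theorem not_X_one_sq_dvd_cube : ¬ (X 1 : MvPowerSeries (Fin 2) k) ^ 2 ∣ (X 1 + X 0) ^ 3 := by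
  intro h
  have h0 := (X_pow_dvd_iff.mp h) (Finsupp.single 0 3) (by simp)
  have hsplit : ((X 1 + X 0) ^ 3 : MvPowerSeries (Fin 2) k) = X 1 * (X 1 ^ 2 + 3 * X 1 * X 0 + 3 * X 0 ^ 2) + X 0 ^ 3 := by ring
  have h1 : coeff (Finsupp.single 0 3) (X 1 * (X 1 ^ 2 + 3 * X 1 * X 0 + 3 * X 0 ^ 2) : MvPowerSeries (Fin 2) k) = 0 :=
    (X_dvd_iff.mp (dvd_mul_right (X 1) _)) _ (by simp)
  rw [hsplit, map_add, h1, zero_add, X_pow_eq, coeff_monomial_same] at h0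
  exact one_ne_zero h0

/-! ## The label before the move: a position with `V(y,u₁)` permissible -/

/-- `A = (u₁²(u₂ + u₁)³, 0)` is a position: `ord A₀ ≥ 5 > 2`, `A₁ = 0`. -/
theorem isPosT_curveOneExample : IsPosT 2 (![X 0 ^ 2 * (X 1 + X 0) ^ 3, 0] : Fin 2 → MvPowerSeries (Fin 2) k) := by
  intro j
  fin_cases j
  · show ((2 - 0 : ℕ) : ℕ∞) < (X 0 ^ 2 * (X 1 + X 0) ^ 3 : MvPowerSeries (Fin 2) k).order
    have h1 : (2 : ℕ∞) ≤ (X 0 ^ 2 : MvPowerSeries (Fin 2) k).order := by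
      rw [X_pow_eq, order_monomial_of_ne_zero one_ne_zero, Finsupp.degree_single]; exact le_rfl
    have hw : (1 : ℕ∞) ≤ (X 1 + X 0 : MvPowerSeries (Fin 2) k).order := by
      rw [one_le_order_iff_constCoeff_eq_zero, map_add, constantCoeff_X, constantCoeff_X, add_zero]
    have h3 : (3 : ℕ∞) ≤ ((X 1 + X 0) ^ 3 : MvPowerSeries (Fin 2) k).order := by
      rw [show ((X 1 + X 0) ^ 3 : MvPowerSeries (Fin 2) k) = (X 1 + X 0) * ((X 1 + X 0) * (X 1 + X 0)) by ring]
      refine le_trans ?_ le_order_mul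
      refine le_trans ?_ (add_le_add hw (le_trans (add_le_add hw hw) le_order_mul))
      norm_num
    have h5 : (5 : ℕ∞) ≤ (X 0 ^ 2 * (X 1 + X 0) ^ 3 : MvPowerSeries (Fin 2) k).order :=
      le_trans (by rw [show (5 : ℕ∞) = 2 + 3 by norm_num]; exact add_le_add h1 h3) le_order_mul
    exact lt_of_lt_of_le (by norm_num) h5
  · show ((2 - 1 : ℕ) : ℕ∞) < (0 : MvPowerSeries (Fin 2) k).order
    rw [order_zero]; exact WithTop.coe_lt_top _

/-- `V(y,u₁)` is permissible for `A`. -/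
theorem isPermissibleOneT_curveOneExample : IsPermissibleOneT 2 (![X 0 ^ 2 * (X 1 + X 0) ^ 3, 0] : Fin 2 → MvPowerSeries (Fin 2) k) := by
  rw [isPermissibleOneT_iff_X_pow_dvd]
  intro j
  fin_cases j
  · exact dvd_mul_right _ _
  · exact dvd_zero _

/-- The `V(y,u₁)`-move: `divOneT 2 A = ((u₂ + u₁)³, 0)`. -/
theorem divOneT_curveOneExample :
    divOneT 2 (![X 0 ^ 2 * (X 1 + X 0) ^ 3, 0] : Fin 2 → MvPowerSeries (Fin 2) k) = ![(X 1 + X 0) ^ 3, 0] := by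
  funext j
  fin_cases j
  · show divOne (2 - 0) (X 0 ^ 2 * (X 1 + X 0) ^ 3 : MvPowerSeries (Fin 2) k) = (X 1 + X 0) ^ 3
    have hA : ∀ e : Fin 2 →₀ ℕ, coeff e (X 0 ^ 2 * (X 1 + X 0) ^ 3 : MvPowerSeries (Fin 2) k) ≠ 0 → 2 ≤ e 0 := by
      intro e he
      by_contra hlt
      exact he ((X_pow_dvd_iff.mp (dvd_mul_right _ _)) e (not_le.mp hlt))
    have h := X_pow_mul_divOne 2 _ hA
    exact mul_left_cancel₀ (pow_ne_zero 2 (X_ne_zero' 0)) h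
  · show divOne (2 - 1) (0 : MvPowerSeries (Fin 2) k) = 0
    ext e
    rw [coeff_divOne, map_zero, map_zero]

/-- The selector strategy's FAMILY SUCCESSOR of `(A, {u₂})` is `(divOneT 2 A, {u₁, u₂})` (first case of `SuccFamilySel`), for every selector. -/
theorem succFamilySel_curveOneExample (ψsel : (Fin 2 → MvPowerSeries (Fin 2) k) → MvPowerSeries (Fin 2) k) :
    SuccFamilySel 2 ψsel (![X 0 ^ 2 * (X 1 + X 0) ^ 3, 0] : Fin 2 → MvPowerSeries (Fin 2) k) {1}
      (![(X 1 + X 0) ^ 3, 0]) (insert 0 (({1} : Finset (Fin 2)).filter fun l => l = 1)) :=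
  Or.inl ⟨isPermissibleOneT_curveOneExample, divOneT_curveOneExample.symm, rfl⟩

/-- The new boundary is `{u₁, u₂}`. -/
theorem boundary_curveOneExample : insert 0 (({1} : Finset (Fin 2)).filter fun l => l = 1) = ({0, 1} : Finset (Fin 2)) := by decide

/-! ## The label after the move: a conflict state -/

/-- After the move `V(y,u₁)` is NOT permissible. -/
theorem not_isPermissibleOneT_curveOneExample_after : ¬ IsPermissibleOneT 2 (![(X 1 + X 0) ^ 3, 0] : Fin 2 → MvPowerSeries (Fin 2) k) := by
  rw [isPermissibleOneT_iff_X_pow_dvd]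
  intro h
  exact not_X_zero_sq_dvd_cube (h 0)

/-- After the move `V(y,u₂)` is NOT permissible. -/
theorem not_isPermissibleTwoT_curveOneExample_after : ¬ IsPermissibleTwoT 2 (![(X 1 + X 0) ^ 3, 0] : Fin 2 → MvPowerSeries (Fin 2) k) := by
  rw [isPermissibleTwoT_iff_X_pow_dvd]
  intro h
  exact not_X_one_sq_dvd_cube (h 0)

/-- After the move the transverse branch `D = V(y, u₂ + u₁)` is a permissible graph curve with datum `h = −1`. -/
theorem graphBranch_curveOneExample_after :
    IsPermissibleTwoT 2 (shift 2 (shearT (C (-1)) (![(X 1 + X 0) ^ 3, 0] : Fin 2 → MvPowerSeries (Fin 2) k)) 0) := by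
  rw [shift_zero', isPermissibleTwoT_iff_X_pow_dvd]
  intro j
  fin_cases j
  · show (X 1 : MvPowerSeries (Fin 2) k) ^ (2 - 0) ∣ shear (C (-1)) ((X 1 + X 0) ^ 3)
    rw [shear_neg_one_branch]
    exact pow_dvd_pow _ (by norm_num)
  · show (X 1 : MvPowerSeries (Fin 2) k) ^ (2 - 1) ∣ shear (C (-1)) 0
    rw [shear_eq, ← coe_substAlgHom (hasSubst_of_constantCoeff_zero (constantCoeff_shearFamily (k := k) (C (-1)))), map_zero]
    exact dvd_zero _

/-- After the move the label has a graph curve (datum `−1`). -/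
theorem hasGraphCurveT_curveOneExample_after : HasGraphCurveT 2 (![(X 1 + X 0) ^ 3, 0] : Fin 2 → MvPowerSeries (Fin 2) k) :=
  ⟨C (-1), 0, C_noY (-1), map_zero _, graphBranch_curveOneExample_after⟩

/-- **REGRESSION TEST #3: A (PSEUDO-)CONFLICT IS BORN AT THE `V(y,u₁)`-MOVE WITH BOTH LETTERS PRESENT.**  For every boundary containing `u₂`
(in particular the successor boundary `{u₁, u₂}` of `(A, {u₂})`), `divOneT 2 A = ((u₂ + u₁)³, 0)` is a conflict state of the TOT2-LINE although
downstairs no two of `V(u₁)`, `V(u₂ + u₁)`, `V(u₂)` are tangent. -/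
theorem conflict_divOneT_curveOneExample (N : Finset (Fin 2)) (hN : (1 : Fin 2) ∈ N) :
    NCPoly.Conflict 2 (divOneT 2 (![X 0 ^ 2 * (X 1 + X 0) ^ 3, 0] : Fin 2 → MvPowerSeries (Fin 2) k)) N := by
  rw [divOneT_curveOneExample]
  exact ⟨not_isPermissibleOneT_curveOneExample_after, not_isPermissibleTwoT_curveOneExample_after, hasGraphCurveT_curveOneExample_after, hN⟩

/-- The same at the successor boundary `{u₁, u₂}`. -/
theorem conflict_succ_curveOneExample :
    NCPoly.Conflict 2 (![(X 1 + X 0) ^ 3, 0] : Fin 2 → MvPowerSeries (Fin 2) k) (insert 0 (({1} : Finset (Fin 2)).filter fun l => l = 1)) := by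
  rw [← divOneT_curveOneExample (k := k)]
  exact conflict_divOneT_curveOneExample _ (by decide)

end TOT2Curve

end Summit.ResolutionOfSingularities.ResolutionOfSingularities.Theorems

end
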